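import Summits.QuantumFields.BalabanUV.Beta.GAN24.DressedVertexFaceBondSum
import Summits.QuantumFields.BalabanUV.Beta.GAN24.MultiplierVertexBondSum

/-!
# `BalabanUV.Beta.GAN24.DressedVertexFacePush` — binder row G-an2-4 ∕ (CONV-C), W-slot (α-0), ROW (C)sym AT LEVELS `≥ 1` (rows T6-STEP of the OWNER's
# two-index tower, RULING R-gan24p1-g40-1): **THE EXIT-FACE BOND SUM OF THE FULL DRESSED VERTEX `dM` READS THE FINE TABLE ON THE DEEPER EXIT CLASS — THE
# MULTIPLIER VERTEX CONTRIBUTES NOTHING** — Part 46 of `GAN24/FourFaceGaugeSectors` (G-an2-4 CRUX TEAM (2), leaf prover `b2b-balaban-gan24-formalise-leaf-02`,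
# gen 69; journal [LEAF02-G69-STAGED2] «NEXT»): the entrywise push law `hpush`, the uniform bi-localisation `hD` and the `(P, Lc·P)`-covariance `hDt` of
# Part 45 `FaceWordsDeepCurrents.faceWord_direct_eq ∕ faceWord_swap_eq` FOR THE ACTUAL DRESSED VERTEX `dM X̃♮_j Lc S M` of leaf-06 K6c's words

NOT IN PRINT; OUR BOOKKEEPING ([folklore] BY NAME over leaf-06 K1a `DressedVertexFaceBondSum.tsum_faceBond_vertexOfK_dressedStep` (the field vertex), leaf-14's
`MultiplierVertexBondSum.hasSum_vertexOfM_bond` (zero bond sum of the multiplier vertex for ANY kernel with zero `colM` masses) fed with road-P2 g41's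
`CoarseGaugeSourceResponse.tsum_coord_colM` (the multiplier column dies against ANY single-coordinate weight in its own direction) through the
column-weighted kernel trick of K1a §1, an2's `SecondOrderResponse.vertexFamily_dM ∕ dM_translate`; 0 `def`, 0 cited fact, 0 `def … : Prop`, 0 sorry).
HONEST FRAMING (cell contract, verbatim): «discharging `BetaPertH` makes Bałaban's UV stability UNCONDITIONAL — a real constructive-QFT result; it is NOT the
continuum limit and NOT the Clay problem.»  HONEST DEPENDENCY (verbatim): «continuum YM on T⁴ ⇐ BetaPertH ∧ nine spine estimates (0/9 proved); BetaPertH ⇐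
(D1) ∧ (D4) ∧ CAP+tail; G-an2-4 gates asym, D1 and NE2/3/4.»

WHAT (generic `d`; `1 ≤ Lc`, in-block root `r ∈ box (d+1) Lc`; ANY units `sf sm`; every level `j`; `X̃ := unitK sf sm (coDressKBmAt (toSite r) Lc (KInvStep Lc j))`;
ANY local stencil family `S` (`LocStencil S Cs δs`, `δs > 0`) and ANY multiplier table `M` localised at the coarse bonds (`VertexFamily M Lc CM δM`, `δM > 0`);
`K_j := (sf·sm)·(stepScale_j·Lc^{d+1})⁻¹`):
* §1 `onLat_smul`, `cwsum_smul_weight`, `vertexOfM_colWeight` (the column-weighted kernel `z ↦ f((blk Lc z)_μ)·X̃ · z` has `colM = f(y_μ)·colM X̃` and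
  `vertexOfM = f(y_μ)·vertexOfM X̃`), `decays_colWeight`, `hasSum_colM_colWeight_zero` (`tsum_coord_colM`), **`hasSum_coordWeight_vertexOfM_dressedStep`**:
  `HasSum (u ↦ f(u_μ)·vertexOfM X̃ Lc M μ u x z a b) 0` for EVERY bounded `f : ℤ → ℝ`; `…_slice`: the same for the slices `M₂ κ u` of a `LocStencilFM` mixed table.
* §2 **`tsum_faceBond_dM_dressedStep`** — THE PUSH LAW in Part 45's literal shape: for every coarse period `P ≥ 1`,
  `Σ'_u [u_μ % P = P−1]·dM X̃ Lc S M μ u x z a b = K_j·Σ'_t [t_μ % (Lc·P) = Lc·P − 1]·S μ t x z a b` (the modulus written `((Lc*P : ℕ) : ℤ)`).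
* §3 **`exists_vertexFamily_dM_dressedStep`** (`∃ CD δ > 0, VertexFamily (dM X̃ Lc S M) Lc CD δ` — Part 45's `hD` after `biLoc_mono` to the common rate) and
  **`dM_dressedStep_translate_coarse`** (`dM X̃ Lc S M κ (u + P•s) = shiftK (−((Lc*P : ℕ)•s)) (dM X̃ Lc S M κ u)` for jointly `Lc`-covariant `S`, `M` — Part 45's `hDt`).
Asserts NO value of any table; discharges NOTHING of (C)_{≥1} ∕ `hstep` ∕ `hSrc` ∕ `hSrcX` ∕ (Q-L) ∕ (hW, hWall); NEVER «G-an2-4 closed» as (CONV-C); NOT D1, NOT `BetaPertH`,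
NOT continuum, NOT Clay.  2026-08-24; no existing file touched.
-/

noncomputable section

open Finset
open scoped BigOperators
open Literature.MathematicalPhysics.QuantumFieldTheory
open Literature.MathematicalPhysics.QuantumFieldTheory.Balaban1983to89
open Literature.MathematicalPhysics.QuantumFieldTheory.Balaban1983to89.Beta
open B12Sec2to5 (l1 l1_nonneg)
open ExpKernelCalculus (Site MKer Decays BiLoc VertexFamily shiftK)
open OneStepResolventKernel (Fib LocStencil)
open AffineAveraging (box toSite)
open AveragingContours (blk)
open AxialProjector (blk_zsmul)
open InterLevelTransport (onLat cwsum cwsum_apply)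
open OneStepKernelFamily (KInvStep decays_KInvStep vertexOfK shiftK_KInvStep)
open SecondOrderResponse (colM vertexOfM dM dM_apply vertexFamily_dM dM_translate)
open Summit.QuantumFields.BalabanUV.Beta.AxialDressingRooted (coDressKBmAt shiftK_coDressKBmAt decays_coDressKBmAt)
open Summit.QuantumFields.BalabanUV.Beta.BorderedHessian (stepScale)
open Summit.QuantumFields.BalabanUV.Beta.HessKerDressedUnits (unitK unitK_apply legScale_inr decays_unitK)
open Summit.QuantumFields.BalabanUV.Beta.GAN24.CoarseGaugeSourceResponse (summable_bdd_mul summable_source_colM tsum_coord_colM)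
open Summit.QuantumFields.BalabanUV.Beta.GAN24.DressedVertexFaceBondSum (hasSum_vertexOfK_dressedStep_coordWeight)
open Summit.QuantumFields.BalabanUV.Beta.GAN24.MultiplierVertexBondSum (hasSum_vertexOfM_bond)

namespace Summit.QuantumFields.BalabanUV.Beta.GAN24.DressedVertexFacePush

variable {d : ℕ} {Lc : ℕ} [NeZero Lc] {r : Fin (d + 1) → ℕ}

/-! ## §1 The multiplier vertex contributes nothing to a single-coordinate-weighted bond sum -/

section ColWeight

variable {X : MKer (d + 1) (Fib d)} {f : ℤ → ℝ} {B : ℝ} (μ : Fin (d + 1))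

omit [NeZero Lc] in
/-- [folklore] `onLat` is linear in the weight: `onLat N (c • w) v = c * onLat N w v`. -/
theorem onLat_smul (N : ℕ) (c : ℝ) (w : Site (d + 1) → ℝ) (v : Site (d + 1)) : onLat N (c • w) v = c * onLat N w v := by
  unfold InterLevelTransport.onLat
  split_ifs <;> simp [Pi.smul_apply, smul_eq_mul]

omit [NeZero Lc] in
/-- [folklore] `cwsum` is linear in the weight, entrywise. -/
theorem cwsum_smul_weight (N : ℕ) (c : ℝ) (w : Site (d + 1) → ℝ) (Q : Site (d + 1) → MKer (d + 1) (Fib d)) (x z : Site (d + 1)) (a b : Fib d) :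
    cwsum N (c • w) Q x z a b = c * cwsum N w Q x z a b := by
  unfold InterLevelTransport.cwsum OneStepResolventKernel.wsum
  rw [← tsum_mul_left]
  refine tsum_congr fun v => ?_
  rw [onLat_smul]
  ring

omit [NeZero Lc] in
/-- [folklore] **THE DIRECTION-LOCKED COLUMN-WEIGHTED KERNEL** `(x, z, a, b) ↦ [b = inr μ]·f((blk Lc z)_μ)·X x z a b`: its multiplier column at the coarse bond
`(μ′, y)` is `f(y_μ)` times that of `X` in the direction `μ′ = μ` and `0` in every other direction. -/
theorem colM_colWeight (hLc : 1 ≤ Lc) (f : ℤ → ℝ) (X : MKer (d + 1) (Fib d)) (μ' : Fin (d + 1)) (y : Site (d + 1)) (ρ : Fin (d + 1)) (w : Site (d + 1)) :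
    colM (fun x z a b => Sum.elim (fun _ : Fin (d + 1) => (0 : ℝ)) (fun μ'' : Fin (d + 1) => if μ'' = μ then f (blk Lc z μ) else 0) b * X x z a b) Lc μ' y ρ w
      = (if μ' = μ then f (y μ) else 0) * colM X Lc μ' y ρ w := by
  simp only [SecondOrderResponse.colM, Sum.elim_inr, blk_zsmul hLc]

omit [NeZero Lc] in
/-- [folklore] … hence its multiplier vertex in the direction `μ` is `f(y_μ)` times that of `X`, entrywise. -/
theorem vertexOfM_colWeight (hLc : 1 ≤ Lc) (f : ℤ → ℝ) (X : MKer (d + 1) (Fib d)) (M : Fin (d + 1) → Site (d + 1) → MKer (d + 1) (Fib d))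
    (y x z : Site (d + 1)) (a b : Fib d) :
    vertexOfM (fun x z a b => Sum.elim (fun _ : Fin (d + 1) => (0 : ℝ)) (fun μ'' : Fin (d + 1) => if μ'' = μ then f (blk Lc z μ) else 0) b * X x z a b) Lc M μ y x z a b
      = f (y μ) * vertexOfM X Lc M μ y x z a b := by
  simp only [SecondOrderResponse.vertexOfM]
  rw [Finset.mul_sum]
  refine Finset.sum_congr rfl fun ρ _ => ?_
  have e : colM (fun x z a b => Sum.elim (fun _ : Fin (d + 1) => (0 : ℝ)) (fun μ'' : Fin (d + 1) => if μ'' = μ then f (blk Lc z μ) else 0) b * X x z a b) Lc μ y ρ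
      = f (y μ) • colM X Lc μ y ρ := by
    funext w
    rw [colM_colWeight μ hLc, if_pos rfl, Pi.smul_apply, smul_eq_mul]
  rw [e, cwsum_smul_weight]

omit [NeZero Lc] in
/-- [folklore] The direction-locked column-weighted kernel decays with the same rate (bounded weight). -/
theorem decays_colWeight {C m : ℝ} (hX : Decays X C m) (hf : ∀ s, |f s| ≤ B) :
    Decays (fun x z a b => Sum.elim (fun _ : Fin (d + 1) => (0 : ℝ)) (fun μ'' : Fin (d + 1) => if μ'' = μ then f (blk Lc z μ) else 0) b * X x z a b) (B * C) m := by
  intro x z a b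
  rw [abs_mul]
  have hB : 0 ≤ B := (abs_nonneg _).trans (hf 0)
  have hw : |Sum.elim (fun _ : Fin (d + 1) => (0 : ℝ)) (fun μ'' : Fin (d + 1) => if μ'' = μ then f (blk Lc z μ) else 0) b| ≤ B := by
    cases b with
    | inl _ => simpa using hB
    | inr μ'' =>
        simp only [Sum.elim_inr]
        split_ifs
        · exact hf _
        · simpa using hB
  calc _ ≤ B * (C * Real.exp (-m * l1 (x - z))) := mul_le_mul hw (hX x z a b) (abs_nonneg _) hB
    _ = B * C * Real.exp (-m * l1 (x - z)) := by ring

/-- [folklore] **ZERO BOND MASSES OF THE COLUMN-WEIGHTED DRESSED STEP KERNEL IN EVERY DIRECTION**: in the direction `μ` by road-P2's `tsum_coord_colM` (the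
multiplier column dies against a single-coordinate weight in its own direction; units are leg-type constants), in the other directions the weight is `0`. -/
theorem hasSum_colM_colWeight_zero (hLc : 1 ≤ Lc) (sf sm : ℝ) (j : ℕ) (f : ℤ → ℝ) (hf : ∀ s, |f s| ≤ B) (μ' ρ : Fin (d + 1)) (w : Site (d + 1)) :
    HasSum (fun y : Site (d + 1) =>
      colM (fun x z a b => Sum.elim (fun _ : Fin (d + 1) => (0 : ℝ)) (fun μ'' : Fin (d + 1) => if μ'' = μ then f (blk Lc z μ) else 0) b *
        unitK sf sm (coDressKBmAt (toSite r) Lc (KInvStep (d := d) Lc j)) x z a b) Lc μ' y ρ w) 0 := by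
  by_cases hμ : μ' = μ
  · subst hμ
    have e : ∀ y : Site (d + 1),
        colM (fun x z a b => Sum.elim (fun _ : Fin (d + 1) => (0 : ℝ)) (fun μ'' : Fin (d + 1) => if μ'' = μ' then f (blk Lc z μ') else 0) b *
            unitK sf sm (coDressKBmAt (toSite r) Lc (KInvStep (d := d) Lc j)) x z a b) Lc μ' y ρ w
          = (sm * sm) * (f (y μ') * colM (coDressKBmAt (toSite r) Lc (KInvStep (d := d) Lc j)) Lc μ' y ρ w) := by
      intro y
      rw [colM_colWeight μ' hLc, if_pos rfl]
      simp only [SecondOrderResponse.colM, unitK_apply, legScale_inr]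
      ring
    have hs : Summable fun y : Site (d + 1) => f (y μ') * colM (coDressKBmAt (toSite r) Lc (KInvStep (d := d) Lc j)) Lc μ' y ρ w :=
      summable_bdd_mul (summable_source_colM (toSite r) j μ' ρ w) (fun y => hf (y μ'))
    have h0 := tsum_coord_colM (Lc := Lc) (toSite r) j μ' f hf ρ w
    have h := hs.hasSum.mul_left (sm * sm)
    rw [h0, mul_zero] at h
    exact h.congr_fun fun y => e y
  · have e : ∀ y : Site (d + 1),
        colM (fun x z a b => Sum.elim (fun _ : Fin (d + 1) => (0 : ℝ)) (fun μ'' : Fin (d + 1) => if μ'' = μ then f (blk Lc z μ) else 0) b *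
            unitK sf sm (coDressKBmAt (toSite r) Lc (KInvStep (d := d) Lc j)) x z a b) Lc μ' y ρ w = 0 := by
      intro y
      rw [colM_colWeight μ hLc, if_neg hμ, zero_mul]
    simp_rw [e]
    exact hasSum_zero

end ColWeight

/-- NOT IN PRINT; OUR BOOKKEEPING.  **THE MULTIPLIER VERTEX CONTRIBUTES NOTHING TO A SINGLE-COORDINATE-WEIGHTED BOND SUM** (every bounded `f : ℤ → ℝ`, every
direction `μ`, every multiplier table `M` localised at the coarse bonds, entrywise): `HasSum (u ↦ f(u_μ)·vertexOfM X̃ Lc M μ u x z a b) 0`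
(`MultiplierVertexBondSum.hasSum_vertexOfM_bond` for the direction-locked column-weighted kernel of §1). -/
theorem hasSum_coordWeight_vertexOfM_dressedStep (hLc : 1 ≤ Lc) (hr : r ∈ box (d + 1) Lc) (sf sm : ℝ) (j : ℕ) (μ : Fin (d + 1))
    (f : ℤ → ℝ) {B : ℝ} (hf : ∀ s, |f s| ≤ B)
    {M : Fin (d + 1) → Site (d + 1) → MKer (d + 1) (Fib d)} {CM δM : ℝ} (hM : VertexFamily M Lc CM δM) (hδM : 0 < δM)
    (x z : Site (d + 1)) (a b : Fib d) :
    HasSum (fun u : Site (d + 1) => f (u μ) * vertexOfM (unitK sf sm (coDressKBmAt (toSite r) Lc (KInvStep (d := d) Lc j))) Lc M μ u x z a b) 0 := by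
  obtain ⟨δ, C', hδ, hC', hK'⟩ := decays_coDressKBmAt hLc hr (decays_KInvStep (d := d) (Lc := Lc) j)
  have hKu := decays_unitK (sf := sf) (sm := sm) hK'
  have hKf := decays_colWeight (Lc := Lc) (f := f) μ hKu hf
  have h := hasSum_vertexOfM_bond (N := Lc) hKf hδ (fun μ' ρ w => hasSum_colM_colWeight_zero (r := r) μ hLc sf sm j f hf μ' ρ w) hM hδM μ x z a b
  refine h.congr_fun fun u => ?_
  exact (vertexOfM_colWeight μ hLc f _ M u x z a b).symm

/-- NOT IN PRINT; OUR BOOKKEEPING.  **THE SAME FOR THE SLICES OF A MIXED TABLE** (the multiplier vertex inside an2's `mixOfK`): for a field–multiplier table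
`M₂` with `LocStencilFM Lc M₂ C₂ δ₂` and every fine bond `(κ, u)`, `HasSum (y ↦ f(y_μ)·vertexOfM X̃ Lc (M₂ κ u) μ y x z a b) 0`
(leaf-14 `hasSum_vertexOfM_bond_locStencilFM` for the column-weighted kernel) — the free-bond MIX word of leaf-06 K6c's third word dies by it. -/
theorem hasSum_coordWeight_vertexOfM_dressedStep_slice (hLc : 1 ≤ Lc) (hr : r ∈ box (d + 1) Lc) (sf sm : ℝ) (j : ℕ) (μ : Fin (d + 1))
    (f : ℤ → ℝ) {B : ℝ} (hf : ∀ s, |f s| ≤ B)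
    {M₂ : Fin (d + 1) → Site (d + 1) → Fin (d + 1) → Site (d + 1) → MKer (d + 1) (Fib d)} {C₂ δ₂ : ℝ}
    (hM₂ : SecondOrderResponse.LocStencilFM Lc M₂ C₂ δ₂) (hδ₂ : 0 < δ₂) (κ : Fin (d + 1)) (u : Site (d + 1))
    (x z : Site (d + 1)) (a b : Fib d) :
    HasSum (fun y : Site (d + 1) => f (y μ) * vertexOfM (unitK sf sm (coDressKBmAt (toSite r) Lc (KInvStep (d := d) Lc j))) Lc (M₂ κ u) μ y x z a b) 0 := by
  obtain ⟨δ, C', hδ, hC', hK'⟩ := decays_coDressKBmAt hLc hr (decays_KInvStep (d := d) (Lc := Lc) j)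
  have hKu := decays_unitK (sf := sf) (sm := sm) hK'
  have hKf := decays_colWeight (Lc := Lc) (f := f) μ hKu hf
  have h := MultiplierVertexBondSum.hasSum_vertexOfM_bond_locStencilFM (N := Lc) hKf hδ
    (fun μ' ρ w => hasSum_colM_colWeight_zero (r := r) μ hLc sf sm j f hf μ' ρ w) hM₂ hδ₂ κ u μ x z a b
  refine h.congr_fun fun y => ?_
  exact (vertexOfM_colWeight μ hLc f _ (M₂ κ u) y x z a b).symm

/-! ## §2 The push law for the full dressed vertex -/

/-- NOT IN PRINT; OUR BOOKKEEPING.  **THE EXIT-FACE BOND SUM OF `dM` AT COARSE PERIOD `P` READS THE FINE TABLE ON THE EXIT CLASS OF PERIOD `Lc·P`** — Part 45's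
`hpush` for the actual dressed vertex: `Σ'_u [u_μ % P = P−1]·dM X̃ Lc S M μ u x z a b = K_j·Σ'_t [t_μ % (Lc·P) = Lc·P−1]·S μ t x z a b`,
`K_j = (sf·sm)·(stepScale_j·Lc^{d+1})⁻¹` (K1a for the field vertex ⨾ §1 for the multiplier vertex). -/
theorem tsum_faceBond_dM_dressedStep (hLc : 1 ≤ Lc) (hr : r ∈ box (d + 1) Lc) (sf sm : ℝ) (j : ℕ) (μ : Fin (d + 1)) {P : ℕ} (hP : 1 ≤ P)
    {S : Fin (d + 1) → Site (d + 1) → MKer (d + 1) (Fib d)} {Cs δs : ℝ} (hS : LocStencil S Cs δs) (hδs : 0 < δs)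
    {M : Fin (d + 1) → Site (d + 1) → MKer (d + 1) (Fib d)} {CM δM : ℝ} (hM : VertexFamily M Lc CM δM) (hδM : 0 < δM)
    (x z : Site (d + 1)) (a b : Fib d) :
    ∑' u : Site (d + 1), (if u μ % (P : ℤ) = (P : ℤ) - 1 then (1 : ℝ) else 0) *
        dM (unitK sf sm (coDressKBmAt (toSite r) Lc (KInvStep (d := d) Lc j))) Lc S M μ u x z a b
      = (sf * sm) * (stepScale d Lc j * (Lc : ℝ) ^ (d + 1))⁻¹ *
        ∑' t : Site (d + 1), (if t μ % ((Lc * P : ℕ) : ℤ) = ((Lc * P : ℕ) : ℤ) - 1 then (1 : ℝ) else 0) * S μ t x z a b := by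
  classical
  have hf : ∀ s : ℤ, |(fun s : ℤ => if s % (P : ℤ) = (P : ℤ) - 1 then (1 : ℝ) else 0) s| ≤ 1 := fun s => by
    simp only; split_ifs <;> simp
  have hK := hasSum_vertexOfK_dressedStep_coordWeight hLc hr sf sm j μ (fun s : ℤ => if s % (P : ℤ) = (P : ℤ) - 1 then (1 : ℝ) else 0) hf hS hδs x z a b
  have hMz := hasSum_coordWeight_vertexOfM_dressedStep hLc hr sf sm j μ (fun s : ℤ => if s % (P : ℤ) = (P : ℤ) - 1 then (1 : ℝ) else 0) hf hM hδM x z a b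
  have hsum := hK.add hMz
  rw [add_zero] at hsum
  have e : ∀ u : Site (d + 1), (if u μ % (P : ℤ) = (P : ℤ) - 1 then (1 : ℝ) else 0) *
        dM (unitK sf sm (coDressKBmAt (toSite r) Lc (KInvStep (d := d) Lc j))) Lc S M μ u x z a b
      = (if u μ % (P : ℤ) = (P : ℤ) - 1 then (1 : ℝ) else 0) * vertexOfK (unitK sf sm (coDressKBmAt (toSite r) Lc (KInvStep (d := d) Lc j))) Lc S μ u x z a b +
        (if u μ % (P : ℤ) = (P : ℤ) - 1 then (1 : ℝ) else 0) * vertexOfM (unitK sf sm (coDressKBmAt (toSite r) Lc (KInvStep (d := d) Lc j))) Lc M μ u x z a b := by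
    intro u; rw [dM_apply]; ring
  simp_rw [e]
  rw [hsum.tsum_eq, mul_assoc (sf * sm) ((stepScale d Lc j * (Lc : ℝ) ^ (d + 1))⁻¹)]
  congr 1
  congr 1
  refine tsum_congr fun t => ?_
  have hLc0 : (0 : ℤ) < Lc := by exact_mod_cast hLc
  have hP0 : (0 : ℤ) < P := by exact_mod_cast hP
  have key := FaceWeightedSandwich.emod_mul_eq_iff hLc0 hP0 (t μ)
  push_cast
  by_cases h1 : t μ % (Lc : ℤ) = (Lc : ℤ) - 1
  · by_cases h2 : t μ / (Lc : ℤ) % (P : ℤ) = (P : ℤ) - 1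
    · rw [if_pos h1, if_pos h2, if_pos (key.2 ⟨h1, h2⟩)]
    · rw [if_pos h1, if_neg h2, if_neg (fun h => h2 (key.1 h).2)]
  · rw [if_neg h1, if_neg (fun h => h1 (key.1 h).1), zero_mul]

/-! ## §3 Uniform bi-localisation and coarse covariance of the dressed vertex -/

/-- NOT IN PRINT; OUR BOOKKEEPING.  **THE DRESSED VERTEX IS A VERTEX FAMILY** (`SecondOrderResponse.vertexFamily_dM` over the decay of `X̃`): `∃ CD δ > 0,
VertexFamily (dM X̃ Lc S M) Lc CD δ` — Part 45's `hD` (`∀ κ u, BiLoc (dM … κ u) (Lc•u) (Lc•u) CD δ`) after `biLoc_mono` to the common rate. -/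
theorem exists_vertexFamily_dM_dressedStep (hLc : 1 ≤ Lc) (hr : r ∈ box (d + 1) Lc) (sf sm : ℝ) (j : ℕ)
    {S : Fin (d + 1) → Site (d + 1) → MKer (d + 1) (Fib d)} {Cs δs : ℝ} (hS : LocStencil S Cs δs) (hδs : 0 < δs)
    {M : Fin (d + 1) → Site (d + 1) → MKer (d + 1) (Fib d)} {CM δM : ℝ} (hM : VertexFamily M Lc CM δM) (hδM : 0 < δM) :
    ∃ CD δ : ℝ, 0 < δ ∧ VertexFamily (dM (unitK sf sm (coDressKBmAt (toSite r) Lc (KInvStep (d := d) Lc j))) Lc S M) Lc CD δ := by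
  obtain ⟨δ, C', hδ, hC', hK'⟩ := decays_coDressKBmAt hLc hr (decays_KInvStep (d := d) (Lc := Lc) j)
  have hKu := decays_unitK (sf := sf) (sm := sm) hK'
  have hCu : 0 ≤ max |sf| |sm| * C' * max |sf| |sm| := hKu.nonneg (Sum.inl 0)
  have hCs : 0 ≤ Cs := (hS 0 0).nonneg (Sum.inl 0)
  have hCM : 0 ≤ CM := (hM 0 0).nonneg (Sum.inl 0)
  set m : ℝ := min δ (min δs δM) with hm
  have hm0 : 0 < m := lt_min hδ (lt_min hδs hδM)
  have hSm : LocStencil S Cs m := fun κ u => OneStepResolventKernel.biLoc_mono (hS κ u) hCs ((min_le_right _ _).trans (min_le_left _ _))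
  have hMm : VertexFamily M Lc CM m := fun ρ w => OneStepResolventKernel.biLoc_mono (hM ρ w) hCM ((min_le_right _ _).trans (min_le_right _ _))
  exact ⟨_, m / 2, half_pos hm0, vertexFamily_dM (N := Lc) hKu hCu hSm hMm hm0 (min_le_left _ _)⟩

/-- NOT IN PRINT; OUR BOOKKEEPING.  **COARSE COVARIANCE OF THE DRESSED VERTEX AT PERIOD `P`** (jointly `Lc`-covariant `S`, `M` in `dM_translate`'s shapes): for every
`P`, `dM X̃ Lc S M κ (u + P•s) = shiftK (−((Lc·P)•s)) (dM X̃ Lc S M κ u)` — Part 45's `hDt` with the deep period `N = Lc·P`. -/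
theorem dM_dressedStep_translate_coarse (hLc : 1 ≤ Lc) (sf sm : ℝ) (j : ℕ) (P : ℕ)
    {S : Fin (d + 1) → Site (d + 1) → MKer (d + 1) (Fib d)} {M : Fin (d + 1) → Site (d + 1) → MKer (d + 1) (Fib d)}
    (hSt : ∀ (κ : Fin (d + 1)) (u t : Site (d + 1)), S κ (u + (Lc : ℤ) • t) = shiftK (-((Lc : ℤ) • t)) (S κ u))
    (hMt : ∀ (ρ : Fin (d + 1)) (w t : Site (d + 1)), M ρ (w + t) = shiftK (-((Lc : ℤ) • t)) (M ρ w))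
    (κ : Fin (d + 1)) (u s : Site (d + 1)) :
    dM (unitK sf sm (coDressKBmAt (toSite r) Lc (KInvStep (d := d) Lc j))) Lc S M κ (u + (P : ℤ) • s)
      = shiftK (-(((Lc * P : ℕ) : ℤ) • s)) (dM (unitK sf sm (coDressKBmAt (toSite r) Lc (KInvStep (d := d) Lc j))) Lc S M κ u) := by
  have hXs : ∀ t : Site (d + 1), shiftK (-((Lc : ℤ) • t)) (unitK sf sm (coDressKBmAt (toSite r) Lc (KInvStep (d := d) Lc j)))
      = unitK sf sm (coDressKBmAt (toSite r) Lc (KInvStep (d := d) Lc j)) := by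
    intro t
    show unitK sf sm (shiftK (-((Lc : ℤ) • t)) (coDressKBmAt (toSite r) Lc (KInvStep (d := d) Lc j))) = _
    rw [shiftK_coDressKBmAt (toSite r) hLc (shiftK_KInvStep (d := d) (Lc := Lc) j) t]
  rw [dM_translate hXs hSt hMt κ u ((P : ℤ) • s)]
  congr 2
  push_cast
  rw [smul_smul]

end Summit.QuantumFields.BalabanUV.Beta.GAN24.DressedVertexFacePush

end
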